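import Literature.NumberTheory.GaloisRepresentations.ConjugationDescent
import Literature.NumberTheory.GaloisRepresentations.BrauerTower
import HarnessLib

/-!
# A class of `H²(G, A)` on whose restriction to an open normal `S₁` some `g₀ ∈ G` acts as the scalar `u` is killed by `(G : S₁)·(1 − u)`

Topic `Literature/NumberTheory/GaloisRepresentations`.  Cell `bsd-print-cf2`, width seat `bsd-line-cf2c-w8` g9: the INDEX step of the local plug (π4b) of
ROW 1 (`…ClassGroupRowCokernelLocal`, `Theorems/…JLKDescentRowOneCokernel`): at a place where the character `θ′` takes the value `−1` on the local layer
group `Λ`, the local group `H²(Λ, μ_{p^k} ⊗ θ′)` is killed by `2·(Λ : Λ ∩ ker θ′) = 4` — from the twist law on `S₁ = Λ ∩ ker θ′`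
(`ContinuousCohomologyConjTwist`: `conj_{g₀} = θ′(g₀) = −1` there, given the local class field theory input) and «a class dying on an open subgroup is
killed by the index» (tree `index_smul_eq_zero_of_resH_eq_zero`).  THEOREMS ONLY; generic profinite-group cohomology.

* `resH_eq_resSubgroup` — the two restriction maps of the tree agree (definitional bridge `Corestriction` ↔ `ContinuousCorestriction`);
* **`index_smul_zsmul_eq_zero_of_conjMap_eq_zsmul`** — if `conj_{g₀} w = u · w` for all `w ∈ H²(S₁, A)` (`g₀ ∈ G`), then
  `(G : S₁) · ((1 − u) · z) = 0` for every `z ∈ H²(G, A)` (`res z` is fixed by `conj_{g₀}`, tree `conjMap_resSubgroup_two`).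

HONEST FRAMING: bookkeeping; no class field theory here; no summit statement is proved by this seat.

## References
* J.-P. Serre, *Galois Cohomology* (1997), I §2.4 Prop. 9 (`Cor ∘ Res = (G : S)`); *Local Fields* (1979), VII §5 Prop. 3. [SerreGaloisCohomology1997] [SerreLocalFields1979]
-/

noncomputable section

open CategoryTheory Function

universe u

namespace Literature.NumberTheory.GaloisRepresentations

open _root_.TopRep _root_.ContinuousCohomology

variable {G : Type u} [Group G] [TopologicalSpace G] [IsTopologicalGroup G] [CompactSpace G] [T2Space G] [TotallyDisconnectedSpace G]
variable {A : Type u} [AddCommGroup A] [TopologicalSpace A] [DiscreteTopology A]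
variable (ρ : ContinuousRep G ℤ A) (S₁ : Subgroup G)

omit [CompactSpace G] [T2Space G] [TotallyDisconnectedSpace G] in
/-- The restriction `resH` of `Corestriction.lean` is the restriction `resSubgroup` of `ContinuousCorestriction.lean` (definitional). [cite: SerreGaloisCohomology1997, I §2.4] -/
theorem resH_eq_resSubgroup (n : ℕ) (z : continuousCohomology n ρ.toTopRep) :
    resH S₁ ρ n z = resSubgroup ρ.toTopRep S₁ n z := rfl

/-- **`(G : S₁)·(1 − u)·z = 0` when `g₀ ∈ G` acts on `H²(S₁, A)` as the scalar `u`**: for an open normal subgroup `S₁` of a profinite group `G`, a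
discrete `G`-module `A`, `g₀ ∈ G` and `u ∈ ℤ` with `conj_{g₀} w = u·w` for all `w ∈ H²(S₁, A)`, every `z ∈ H²(G, A)` satisfies `(G : S₁)·((1−u)·z) = 0`
(the restriction of `z` is fixed by `conj_{g₀}`, hence killed by `1 − u`; a class dying on `S₁` is killed by the index).  With `u = −1`, `(G : S₁) = 2`:
`4z = 0`. [cite: SerreGaloisCohomology1997, I §2.4 Prop. 9] [cite: SerreLocalFields1979, VII §5 Prop. 3] -/
theorem index_smul_zsmul_eq_zero_of_conjMap_eq_zsmul [S₁.Normal] [LocallyCompactSpace S₁] (hS₁ : IsOpen (S₁ : Set G)) (g₀ : G) (u : ℤ)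
    (hconj : ∀ w : continuousCohomology 2 (subgroupRep ρ.toTopRep S₁), conjMap ρ.toTopRep S₁ g₀ 2 w = u • w)
    (z : continuousCohomology 2 ρ.toTopRep) : S₁.index • ((1 - u) • z) = 0 := by
  have hw : (1 - u) • resSubgroup ρ.toTopRep S₁ 2 z = 0 := by
    rw [sub_zsmul, one_zsmul, ← hconj, conjMap_resSubgroup_two, add_neg_cancel]
  refine index_smul_eq_zero_of_resH_eq_zero ρ S₁ hS₁ _ ?_
  change resSubgroup ρ.toTopRep S₁ 2 ((1 - u) • z) = 0
  rw [map_zsmul, hw]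

end Literature.NumberTheory.GaloisRepresentations

end
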